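import Summits.BirchSwinnertonDyer.BirchSwinnertonDyer.Theorems.KatoDescentPotSupersingularReducibleZetaDivisibilityOfMember
import Summits.BirchSwinnertonDyer.BirchSwinnertonDyer.Theorems.KatoDescentPotSupersingularIntegralH1RankZeroIndex
import Literature.NumberTheory.EllipticCurves.IwasawaEulerCharDivisibilityProofs
import Literature.NumberTheory.EllipticCurves.IwasawaEulerCharRankZeroProofs
import Literature.NumberTheory.EllipticCurves.KatoFineSelmerDualMuProofs
import Literature.NumberTheory.EllipticCurves.Kato2004.MainConjectureDescentSkeletonProofs
import Literature.NumberTheory.EllipticCurves.Kato2004.IntegralH1FiniteProofs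
import HarnessLib

/-!
# Kato's Thm. 14.5 (3) ON THE FINE-SELMER ROAD, at the `Γ`-(co)invariant level, for the REDUCIBLE non-CM
# rank-0 rows of crux M: `#Sel₀(W/ℚ_∞)^Γ ∣ #Sel₀(W/ℚ_∞)_Γ · [𝐇¹_Γ/T : 𝐲̄]` and
# `[𝐇¹_Γ/T : 𝐲̄] ∣ [H¹(ℤ[1/p], T_pW) : ℤ_p·𝐲₀]` — the first LEVEL-0 brick of the COUNT

Seat `bsd-potss-rkm` g16 (prover; cell `bsd-potss`), item stmt-BirchSwinnertonDyer-19196 `ReducibleKatoMember` = crux M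
of K9 `KatoDescentPotSupersingular` / K8-t′ `KatoDescentTamePotSupersingular` (`--supports … --as helper`; closes
nothing).  HONEST FRAMING (cell): BSD is not proved by any of this; nothing is booked; crux M stays cite-level on
{modularity, `Kato2004.exists_memberHullZetaInputs`}.  This file descends the Λ-adic half of the road
«M ⟸ general facts» (rkm g15: `char_Λ X₀(W/ℚ_∞) ∣ char_Λ(𝐇¹_Γ/Λ𝐲)`, modulo {Kato 13.4, Serre III.7.9 (a),
Ferrero–Washington, Lim 3.5}) to the `Γ = ⟨γ⟩`-(co)invariants — Kato's §14.14 step "Thm. 14.5 (3)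
`#H²(ℤ[1/p],T) ≤ [H¹(ℤ[1/p],T) : z]`" with the dual fine Selmer group `X₀` in place of Kato's `𝐇²(T)⁰`
(the tree has no `𝐇²`; on Kato's objects `X₀ ↪ 𝐇²(T)⁰` with finite cokernel by Poitou–Tate along the tower).

WHAT (all on a row of crux M: `W/ℚ` elliptic non-CM, `p ≠ 2`, `E[p]` REDUCIBLE, `W(ℚ)` and `Ш(W)[p^∞]` finite;
the cyclotomic `(κ, γ)`, pinned `I : IwasawaH1Data`, ANY dual fine Selmer datum `Y`):

* §1 (the pin, unconditional) `natCard_coinvariants_quotient_span_dvd_index`: for every `y ∈ 𝐇¹_Γ(T_pW)`,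
  **`#((𝐇¹_Γ/T𝐇¹_Γ) ⧸ Λ·ȳ) ∣ #(H¹(ℤ[1/p],T_pW) ⧸ ℤ_p·y₀)`**, `y₀ = proj₀ y` (the induced map is injective by
  Kato's (14.14.1)-injectivity `TwistTate.mem_TSubmodule_of_proj_zero_eq_zero`, rkm g8); and
  `finite_coinvariants_quotient_span_of_not_isOfFinAddOrder`: if `y₀` has infinite order both are FINITE
  ((R0) `rank_{ℤ_p} H¹(ℤ[1/p],T_pW) ≤ 1`, rkm g9).
* §2 (general Euler-system class) `natCard_fineSelmer_invariants_dvd_of_isEulerSystemClass_of_not_irreducible`: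
  for a genuine Λ-adic Euler-system class `s` with `proj₀ s` of infinite order,
  **`Sel₀(W/ℚ_∞)^Γ`, `Sel₀(W/ℚ_∞)_Γ` are finite and `#Sel₀(W/ℚ_∞)^Γ ∣ #Sel₀(W/ℚ_∞)_Γ · #((𝐇¹_Γ/T) ⧸ Λ·s̄)`**,
  modulo {13.4, Serre, FW, Lim 3.5}: the divisibility of characteristic ideals (rkm g15
  `SmallImageEulerSystemBoundOffP.charIdeal_le_charIdeal_fineSelmerDual_of_not_irreducible`) descended by the
  `Γ`-Euler-characteristic calculus (`IwasawaAlgebra.natCard_coinvariants_mul_dvd_of_charIdeal_le`, rkm g16;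
  `(𝐇¹_Γ/Λs)[T] = 0` and `(𝐇¹_Γ/Λs)/T ≅ (𝐇¹_Γ/T)/s̄`, kmc's `Kato2004.natCard_…_quotient_span…`) and read on
  `Sel₀` through the Pontryagin dual pair (`FineSelmerDualData.isDualPair`: `#(X₀/TX₀) = #Sel₀^Γ`, `#X₀[T] = #(Sel₀)_Γ`);
  `…_dvd_index_…`: the same with `[H¹(ℤ[1/p],T_pW) : ℤ_p·s₀]` on the right.
* §3 (Kato's own zeta class) `natCard_fineSelmer_invariants_dvd_index_zetaLift`: the same for the Λ-adic lift `𝐲`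
  of a `ZetaBody` family passing the value guards (`𝐲₀` of infinite order FROM THE VALUE,
  `MemberIndexOfValue.not_isOfFinAddOrder_proj_zero_of_zetaBody`, rkm g10), and the member-free `∃`-form
  `exists_zetaLift_natCard_fineSelmer_invariants_dvd_index` over {Z0, 13.4, Serre, FW, Lim 3.5}: on every
  reducible non-CM rank-0 row with `L(W,1) ≠ 0` there is a non-zero genuine Euler-system class `𝐲` with
  `#Sel₀(W/ℚ_∞)^Γ ∣ #Sel₀(W/ℚ_∞)_Γ · [H¹(ℤ[1/p],T_pW) : ℤ_p·𝐲₀]`, all three finite.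

WHAT THIS IS NOT (the rest of the COUNT, memo `FINDING-19196-rkm-g16.md`): the level-0 control
`#Sel₀(W/ℚ) ≤ #W(ℚ)[p^∞] · #Sel₀(W/ℚ_∞)^Γ`, the Poitou–Tate comparison `#Sel_{p^∞} = #Sel₀ · [H¹_s(ℚ_p,T) : loc_s]`,
the value/local index `[H¹_s(ℚ_p,T) : loc_s 𝐲₀] = p^{ord(L^{(S)}(W,1)/Ω) + t_p − v_p(c_p)}`, and the `(Sel₀)_Γ` term
(on Kato's objects `#X₀[T] ≤ #𝐇²[T] = #coker(𝐇¹_Γ/T → H¹(ℤ[1/p],T))`, but the `X₀`-road is lossy by the local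
`H²` term `#W(ℚ_p)[p^∞]`).  References: [Kato2004Asterisque] Thm. 13.4 (p. 226), Thm. 14.5 (p. 236), §14.14 and
Lemma 14.15 (pp. 243–244); [GreenbergLNM1716] §4 Lemma 4.2 (p. 102); [Wuthrich2014] Lemma 14; [SilvermanAEC2009]
III.7.9 (a); [Lim2017FineSelmer] Thm. 3.5.
-/

-- the summit and its single problem are both named `BirchSwinnertonDyer` (registry layout D-0017)
set_option linter.dupNamespace false
set_option autoImplicit false

noncomputable section

open scoped NumberField TensorProduct
open Field IsDedekindDomain WeierstrassCurve CongruenceSubgroup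
open Literature.NumberTheory.GaloisRepresentations Literature.NumberTheory.EllipticCurves
open Literature.NumberTheory.EllipticCurves.ModularForms
open Literature.NumberTheory.EllipticCurves.Kato2004 Literature.NumberTheory.EllipticCurves.Kato2004.EulerSystemValues
open Literature.NumberTheory.EllipticCurves.IwasawaAlgebra Literature.NumberTheory.EllipticCurves.IwasawaDual

namespace Summit.BirchSwinnertonDyer.BirchSwinnertonDyer.Theorems.ReducibleFineSelmerDescentCount

/-! ## §1 The pin: `[𝐇¹_Γ/T : ȳ] ∣ [H¹(ℤ[1/p],T_pW) : ℤ_p·y₀]`, both finite when `y₀` has infinite order -/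

section Pin

variable {W : WeierstrassCurve ℚ} [W.IsElliptic] {p : ℕ} [Fact p.Prime]
  [ContinuousSMul ℤ_[p] (W.tateModule p)] {κ : ZpExtension ℚ p} {γ : absoluteGaloisGroup ℚ}

/-- **`#((𝐇¹_Γ/T𝐇¹_Γ) ⧸ Λ·ȳ) ∣ #(H¹(ℤ[1/p],T_pW) ⧸ ℤ_p·y₀)`** (`y₀ = proj₀ y`, `κ` cyclotomic, `γ` a topological
generator): `proj₀` induces an additive map `(𝐇¹_Γ/T)/Λȳ → H¹(ℤ[1/p],T_pW)/ℤ_p y₀`, injective because `proj₀` is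
injective on `𝐇¹_Γ/T` (Kato's (14.14.1), tree theorem `TwistTate.mem_TSubmodule_of_proj_zero_eq_zero`) and
`proj₀(Λ·y) = ℤ_p·y₀`; an injective map of groups makes `Nat.card` divide (`0 ∣ 0` if both are infinite).
[cite: Kato2004Asterisque, §14.14 (14.14.1) (p. 243)] -/
theorem natCard_coinvariants_quotient_span_dvd_index (hκ : κ.IsCyclotomic) (hγ : κ.IsTopGenerator γ)
    (I : IwasawaH1Data W p κ γ) (y : I.H) :
    Nat.card (coinvariants p I.H ⧸
        Submodule.span (IwasawaAlgebra p) {(Submodule.Quotient.mk y : coinvariants p I.H)}) ∣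
      Nat.card (integralH1 (tateRep W p) p (κ.layerSubgroup 0) ⧸
        Submodule.span ℤ_[p] {(⟨I.proj 0 y, I.proj_mem 0 y⟩ : integralH1 (tateRep W p) p (κ.layerSubgroup 0))}) := by
  set ybar : coinvariants p I.H := Submodule.Quotient.mk y with hybar
  set y₀ : integralH1 (tateRep W p) p (κ.layerSubgroup 0) := ⟨I.proj 0 y, I.proj_mem 0 y⟩ with hy₀
  set S : Submodule (IwasawaAlgebra p) (coinvariants p I.H) := Submodule.span (IwasawaAlgebra p) {ybar}
  set S' : Submodule ℤ_[p] (integralH1 (tateRep W p) p (κ.layerSubgroup 0)) := Submodule.span ℤ_[p] {y₀}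
  -- `proj₀(Λ·ȳ) ⊆ ℤ_p·y₀`
  have hle : S.toAddSubgroup ≤ S'.toAddSubgroup.comap I.projZeroIntegral := by
    intro w hw
    obtain ⟨g, rfl⟩ := Submodule.mem_span_singleton.mp (show w ∈ S from hw)
    change I.projZeroIntegral (g • ybar) ∈ S'
    refine Submodule.mem_span_singleton.mpr ⟨PowerSeries.constantCoeff g, Subtype.ext ?_⟩
    change PowerSeries.constantCoeff g • I.proj 0 y = (I.projZeroIntegral (g • ybar) : H1 (tateRep W p) _)
    rw [IwasawaH1Data.coe_projZeroIntegral, hybar, ← Submodule.Quotient.mk_smul, IwasawaH1Data.projZero_mk,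
      I.proj_zero_smul]
  let ψ := QuotientAddGroup.map S.toAddSubgroup S'.toAddSubgroup I.projZeroIntegral hle
  -- `ψ` is injective
  have hψ : Function.Injective ψ := by
    rw [injective_iff_map_eq_zero]
    intro q hq
    induction q using QuotientAddGroup.induction_on with
    | H w =>
      have hw : I.projZeroIntegral w ∈ S' := by
        have h1 : ψ (QuotientAddGroup.mk w) = QuotientAddGroup.mk (I.projZeroIntegral w) := rfl
        rw [h1, QuotientAddGroup.eq_zero_iff] at hq
        exact hq
      obtain ⟨c, hc⟩ := Submodule.mem_span_singleton.mp hw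
      have hc' : c • I.proj 0 y = I.projZero w := by
        have := congrArg Subtype.val hc
        simpa [hy₀] using this
      rw [QuotientAddGroup.eq_zero_iff]
      change w ∈ S
      induction w using Submodule.Quotient.induction_on with
      | H x =>
        rw [IwasawaH1Data.projZero_mk] at hc'
        -- `proj₀ (x - C c • y) = 0`, so `x - C c • y ∈ T·𝐇¹_Γ`
        have h0 : I.proj 0 (x - PowerSeries.C c • y) = 0 := by
          rw [map_sub, I.proj_C_smul, hc', sub_self]
        have hT := TwistTate.mem_TSubmodule_of_proj_zero_eq_zero W p κ hκ hγ I _ h0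
        have hmk : (Submodule.Quotient.mk x : coinvariants p I.H) = PowerSeries.C c • ybar := by
          rw [hybar, ← Submodule.Quotient.mk_smul, eq_comm, ← sub_eq_zero, ← Submodule.Quotient.mk_sub,
            Submodule.Quotient.mk_eq_zero, ← neg_sub]
          exact Submodule.neg_mem _ hT
        rw [hmk]
        exact Submodule.smul_mem _ _ (Submodule.mem_span_singleton_self ybar)
  exact AddSubgroup.card_dvd_of_injective ψ hψ

/-- **If `y₀ = proj₀ y` has infinite order on a rank-0 row (`W(ℚ)`, `Ш(W)[p^∞]` finite) then
`H¹(ℤ[1/p],T_pW)/ℤ_p y₀` and `(𝐇¹_Γ/T)/Λȳ` are finite** — (R0) `rank_{ℤ_p} H¹(ℤ[1/p],T_pW) ≤ 1`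
(`IntegralH1RankZero.rank_integralH1_layerZero_le_one`, rkm g9; `finite_quotient_of_rank_le_one`) and the injection of
`natCard_coinvariants_quotient_span_dvd_index`. [cite: Kato2004Asterisque, 14.13 (p. 243) and Thm. 14.5 (1)–(2) (p. 236)] -/
theorem finite_quotient_span_of_not_isOfFinAddOrder [Finite W.toAffine.Point]
    [Finite (AddCommGroup.primaryComponent W.sha p)] (I : IwasawaH1Data W p κ γ) (y : I.H)
    (hnt : ¬ IsOfFinAddOrder (I.proj 0 y)) :
    Finite (integralH1 (tateRep W p) p (κ.layerSubgroup 0) ⧸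
        Submodule.span ℤ_[p] {(⟨I.proj 0 y, I.proj_mem 0 y⟩ : integralH1 (tateRep W p) p (κ.layerSubgroup 0))}) := by
  haveI := module_finite_integralH1_layerZero W p κ
  refine IntegralH1RankZero.finite_quotient_of_rank_le_one p
    (IntegralH1RankZero.rank_integralH1_layerZero_le_one W p κ) _
    (Submodule.mem_span_singleton_self _) fun h ↦ hnt ?_
  obtain ⟨n, hn, hny⟩ := h.exists_nsmul_eq_zero
  exact isOfFinAddOrder_iff_nsmul_eq_zero.mpr ⟨n, hn, by simpa using congrArg Subtype.val hny⟩

/-- **`(𝐇¹_Γ/T)/Λȳ` and `(𝐇¹_Γ/Λy)/T` are finite when `proj₀ y` has infinite order** on a rank-0 row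
(`κ` cyclotomic, `γ` a topological generator). [cite: Kato2004Asterisque, §14.14 (14.14.1) (p. 243), Thm. 14.5 (2) (p. 236)] -/
theorem finite_coinvariants_quotient_span_of_not_isOfFinAddOrder [Finite W.toAffine.Point]
    [Finite (AddCommGroup.primaryComponent W.sha p)] (hκ : κ.IsCyclotomic) (hγ : κ.IsTopGenerator γ)
    (I : IwasawaH1Data W p κ γ) (y : I.H) (hnt : ¬ IsOfFinAddOrder (I.proj 0 y)) :
    Finite (coinvariants p I.H ⧸
        Submodule.span (IwasawaAlgebra p) {(Submodule.Quotient.mk y : coinvariants p I.H)}) ∧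
      Finite (coinvariants p (I.H ⧸ Submodule.span (IwasawaAlgebra p) {y})) := by
  haveI := finite_quotient_span_of_not_isOfFinAddOrder I y hnt
  have hne : Nat.card (integralH1 (tateRep W p) p (κ.layerSubgroup 0) ⧸
      Submodule.span ℤ_[p] {(⟨I.proj 0 y, I.proj_mem 0 y⟩ :
        integralH1 (tateRep W p) p (κ.layerSubgroup 0))}) ≠ 0 := Nat.card_pos.ne'
  have hdvd := natCard_coinvariants_quotient_span_dvd_index hκ hγ I y
  have h1 : Nat.card (coinvariants p I.H ⧸
      Submodule.span (IwasawaAlgebra p) {(Submodule.Quotient.mk y : coinvariants p I.H)}) ≠ 0 :=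
    fun h0 ↦ hne (Nat.eq_zero_of_zero_dvd (h0 ▸ hdvd))
  have h2 : Nat.card (coinvariants p (I.H ⧸ Submodule.span (IwasawaAlgebra p) {y})) ≠ 0 := by
    rw [Kato2004.natCard_coinvariants_quotient_span y]; exact h1
  exact ⟨Nat.finite_of_card_ne_zero h1, Nat.finite_of_card_ne_zero h2⟩

end Pin

/-! ## §2 Any genuine Euler-system class on a reducible non-CM rank-0 row -/

section EulerSystemClass

variable (W : WeierstrassCurve ℚ) [W.IsElliptic] (p : ℕ) [Fact p.Prime]
  [ContinuousSMul ℤ_[p] (W.tateModule p)] [Module.Free ℤ_[p] (W.tateModule p)]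
  [Module.Finite ℤ_[p] (W.tateModule p)]
  [Finite W.toAffine.Point] [Finite (AddCommGroup.primaryComponent W.sha p)]
  {κ : ZpExtension ℚ p} {γ : absoluteGaloisGroup ℚ}

/-- **Kato Thm. 14.5 (3) on the fine road, `Γ`-level, reducible non-CM rank-0 rows.**  For `W/ℚ` elliptic non-CM,
`p ≠ 2`, `E[p]` reducible, `W(ℚ)` and `Ш(W)[p^∞]` finite, the cyclotomic `(κ, γ)`, pinned `I`, ANY dual fine Selmer
datum `Y`, and a genuine Λ-adic Euler-system class `s ∈ 𝐇¹_Γ(T_pW)` whose bottom class `proj₀ s` has infinite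
order: `Sel₀(W/ℚ_∞)^Γ` and `Sel₀(W/ℚ_∞)_Γ` are FINITE and
**`#Sel₀(W/ℚ_∞)^Γ ∣ #Sel₀(W/ℚ_∞)_Γ · #((𝐇¹_Γ/T𝐇¹_Γ) ⧸ Λ·s̄)`**, modulo {`thm13_4_…`, `serre_adicImage_…`,
`ferreroWashington1979_…`, `Lim2017.thm35_…`}.  (`Γ`-invariants / coinvariants of `Sel₀(W/ℚ_∞, W[p^∞])` for
`γ`: `endInvariants` / `EndCoinvariants` of `conj_γ − 1`.) [cite: Kato2004Asterisque, Thm. 13.4 (2) (p. 226), Thm. 14.5 (3) (p. 236), §14.14 and Lemma 14.15 (pp. 243–244)]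
[cite: GreenbergLNM1716, §4 Lemma 4.2 (p. 102)] [cite: Wuthrich2014, Lemma 14 (p. 396)] -/
theorem natCard_fineSelmer_invariants_dvd_of_isEulerSystemClass_of_not_irreducible
    (h134 : thm13_4_lengthAt_fineSelmerDual_le_of_isEulerSystemClass)
    (hSerre : serre_adicImage_contains_congruenceSubgroup)
    (hLim : Lim2017.thm35_fineSelmerDual_moduleFinite_of_classicalMuVanishes_of_le_divisionField)
    (hFW : Literature.NumberTheory.IwasawaTheory.ferreroWashington1979_classicalMuVanishes)
    (hp : p ≠ 2) (hκ : κ.IsCyclotomic) (hγ : κ.IsTopGenerator γ) (hCM : ¬ W.HasCM)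
    (hred : ¬ W.HasIrreducibleModPGaloisRep p) (I : IwasawaH1Data W p κ γ) (Y : W.FineSelmerDualData κ γ)
    (s : I.H) (hs : IsEulerSystemClass W p κ γ I s) (hnt : ¬ IsOfFinAddOrder (I.proj 0 s)) :
    Finite (endInvariants (W.conjFineSelmerInfty κ γ - 1)) ∧
      Finite (EndCoinvariants (W.conjFineSelmerInfty κ γ - 1)) ∧
      Nat.card (endInvariants (W.conjFineSelmerInfty κ γ - 1)) ∣
        Nat.card (EndCoinvariants (W.conjFineSelmerInfty κ γ - 1)) *
          Nat.card (coinvariants p I.H ⧸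
            Submodule.span (IwasawaAlgebra p) {(Submodule.Quotient.mk s : coinvariants p I.H)}) := by
  have hs0 : s ≠ 0 := by
    rintro rfl
    exact hnt (by rw [map_zero]; exact isOfFinAddOrder_iff_nsmul_eq_zero.mpr ⟨1, one_pos, by simp⟩)
  -- the Λ-modules `N = 𝐇¹_Γ/Λs` (f.g. torsion) and `M = X₀` (f.g. torsion on a reducible row)
  haveI : Module.Finite (IwasawaAlgebra p) I.H := IwasawaH1Data.module_finite_of_isCyclotomic hκ hγ I
  haveI := I.noZeroSMulDivisors hγ
  have htors : Module.IsTorsion (IwasawaAlgebra p) (I.H ⧸ Submodule.span (IwasawaAlgebra p) {s}) :=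
    ReducibleZetaDivisibility.isTorsion_quotient_span_singleton_of_ne_zero W p hκ hγ I hs0
  have hA := ReducibleFineSelmerMuZero.fineSelmerDual_moduleFinite_of_not_irreducible hLim hFW W p hp
    hred κ hκ
  have hfinp : Set.Finite {t : W.fineSelmerInfty κ | p • t = 0} :=
    (IwasawaModuleFinitePadicInt.exists_fineSelmerDualData_moduleFinite_iff_finite_pTorsion W κ hγ).mp hA
  haveI : Module.Finite (IwasawaAlgebra p) Y.X := Y.module_finite_of_finite_pTorsion hγ hfinp
  haveI : Finite (Y.X ⧸ (IwasawaAlgebra.augIdealP p • (⊤ : Submodule (IwasawaAlgebra p) Y.X))) :=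
    Y.finite_quotient_augIdealP_of_finite_pTorsion hfinp
  have hYtors : Module.IsTorsion (IwasawaAlgebra p) Y.X :=
    IwasawaModuleFinitePadicInt.isTorsion_of_finite_quotient_augIdealP p Y.X inferInstance
  -- the Λ-adic divisibility (rkm g15) and the finiteness of `N/TN` (§1)
  have hchar := SmallImageEulerSystemBoundOffP.charIdeal_le_charIdeal_fineSelmerDual_of_not_irreducible h134
    hSerre hLim hFW W p κ γ hp hκ hγ hCM hred I Y s hs hs0 htors
  obtain ⟨hfin1, hfinN⟩ := finite_coinvariants_quotient_span_of_not_isOfFinAddOrder hκ hγ I s hnt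
  -- descend to the `Γ`-(co)invariants
  obtain ⟨hiM, hcM, hiN⟩ := finite_coinvariants_of_charIdeal_le hYtors htors hchar hfinN
  have hdvd := natCard_coinvariants_mul_dvd_of_charIdeal_le hYtors htors hchar hfinN
  rw [Kato2004.natCard_invariants_quotient_span_eq_one s hs0 hiN, mul_one,
    Kato2004.natCard_coinvariants_quotient_span s] at hdvd
  -- read on `Sel₀(W/ℚ_∞)` through the dual pair
  have hD := Y.isDualPair hγ
  refine ⟨hD.finite_coinvariants_iff.mp hcM, hD.finite_invariants_iff.mp hiM, ?_⟩
  rw [← hD.natCard_coinvariants, ← hD.natCard_invariants]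
  exact hdvd

/-- **The same with Kato's index on the right: `#Sel₀(W/ℚ_∞)^Γ ∣ #Sel₀(W/ℚ_∞)_Γ · [H¹(ℤ[1/p],T_pW) : ℤ_p·s₀]`**,
`s₀ = proj₀ s`, all three finite (§1: `[𝐇¹_Γ/T : s̄] ∣ [H¹(ℤ[1/p],T_pW) : ℤ_p s₀]`), modulo {13.4, Serre, FW, Lim 3.5}.
[cite: Kato2004Asterisque, Thm. 14.5 (3) (p. 236), §14.14 (pp. 243–244)] [cite: GreenbergLNM1716, §4 Lemma 4.2 (p. 102)] -/
theorem natCard_fineSelmer_invariants_dvd_index_of_isEulerSystemClass_of_not_irreducible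
    (h134 : thm13_4_lengthAt_fineSelmerDual_le_of_isEulerSystemClass)
    (hSerre : serre_adicImage_contains_congruenceSubgroup)
    (hLim : Lim2017.thm35_fineSelmerDual_moduleFinite_of_classicalMuVanishes_of_le_divisionField)
    (hFW : Literature.NumberTheory.IwasawaTheory.ferreroWashington1979_classicalMuVanishes)
    (hp : p ≠ 2) (hκ : κ.IsCyclotomic) (hγ : κ.IsTopGenerator γ) (hCM : ¬ W.HasCM)
    (hred : ¬ W.HasIrreducibleModPGaloisRep p) (I : IwasawaH1Data W p κ γ) (Y : W.FineSelmerDualData κ γ)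
    (s : I.H) (hs : IsEulerSystemClass W p κ γ I s) (hnt : ¬ IsOfFinAddOrder (I.proj 0 s)) :
    Finite (endInvariants (W.conjFineSelmerInfty κ γ - 1)) ∧
      Finite (EndCoinvariants (W.conjFineSelmerInfty κ γ - 1)) ∧
      Finite (integralH1 (tateRep W p) p (κ.layerSubgroup 0) ⧸
        Submodule.span ℤ_[p] {(⟨I.proj 0 s, I.proj_mem 0 s⟩ : integralH1 (tateRep W p) p (κ.layerSubgroup 0))}) ∧
      Nat.card (endInvariants (W.conjFineSelmerInfty κ γ - 1)) ∣
        Nat.card (EndCoinvariants (W.conjFineSelmerInfty κ γ - 1)) *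
          Nat.card (integralH1 (tateRep W p) p (κ.layerSubgroup 0) ⧸
            Submodule.span ℤ_[p] {(⟨I.proj 0 s, I.proj_mem 0 s⟩ :
              integralH1 (tateRep W p) p (κ.layerSubgroup 0))}) := by
  obtain ⟨h1, h2, h3⟩ := natCard_fineSelmer_invariants_dvd_of_isEulerSystemClass_of_not_irreducible W p h134
    hSerre hLim hFW hp hκ hγ hCM hred I Y s hs hnt
  exact ⟨h1, h2, finite_quotient_span_of_not_isOfFinAddOrder I s hnt,
    h3.trans (mul_dvd_mul_left _ (natCard_coinvariants_quotient_span_dvd_index hκ hγ I s))⟩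

end EulerSystemClass

/-! ## §3 Kato's own zeta class, and the member-free `∃`-form over Z0 -/

section Zeta

variable (W : WeierstrassCurve ℚ) [W.IsElliptic] (p : ℕ) [Fact p.Prime]
  [ContinuousSMul ℤ_[p] (W.tateModule p)] [Module.Free ℤ_[p] (W.tateModule p)]
  [Module.Finite ℤ_[p] (W.tateModule p)]
  [Finite W.toAffine.Point] [Finite (AddCommGroup.primaryComponent W.sha p)]
  {κ : ZpExtension ℚ p} {γ : absoluteGaloisGroup ℚ}

/-- **Kato Thm. 14.5 (3) on the fine road for KATO'S OWN zeta class**: for a `ZetaBody` family on `T_pW` whose `f` is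
the newform of a curve `V` with `L(V,1) ≠ 0` and whose data pass the value guards (`κ′ ≠ 0`, `A ≥ 1`, `(cd, A) = 1`,
`dd′ ≡ 1 (A)`, non-zero cusp factor) and its Λ-adic lift `𝐲`, on a reducible non-CM rank-0 row:
`Sel₀(W/ℚ_∞)^Γ`, `Sel₀(W/ℚ_∞)_Γ`, `H¹(ℤ[1/p],T_pW)/ℤ_p𝐲₀` are finite and
**`#Sel₀(W/ℚ_∞)^Γ ∣ #Sel₀(W/ℚ_∞)_Γ · [H¹(ℤ[1/p],T_pW) : ℤ_p·𝐲₀]`**, modulo {13.4, Serre, FW, Lim 3.5} — `𝐲` is a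
genuine Euler-system class (`isEulerSystemClass_of_zetaBody`, rkm g15) and `𝐲₀` has infinite order from the VALUE
(`MemberIndexOfValue.not_isOfFinAddOrder_proj_zero_of_zetaBody`, rkm g10).
[cite: Kato2004Asterisque, Thm. 12.5 (p. 221), Thm. 14.5 (2)–(3) (p. 236), §14.14 (pp. 243–244)] [cite: GreenbergLNM1716, §4 Lemma 4.2 (p. 102)] -/
theorem natCard_fineSelmer_invariants_dvd_index_zetaLift
    (h134 : thm13_4_lengthAt_fineSelmerDual_le_of_isEulerSystemClass)
    (hSerre : serre_adicImage_contains_congruenceSubgroup)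
    (hLim : Lim2017.thm35_fineSelmerDual_moduleFinite_of_classicalMuVanishes_of_le_divisionField)
    (hFW : Literature.NumberTheory.IwasawaTheory.ferreroWashington1979_classicalMuVanishes)
    (hp : p ≠ 2) (hκ : κ.IsCyclotomic) (hγ : κ.IsTopGenerator γ) (hCM : ¬ W.HasCM)
    (hred : ¬ W.HasIrreducibleModPGaloisRep p) (I : IwasawaH1Data W p κ γ) (Y : W.FineSelmerDualData κ γ)
    {N : ℕ} [NeZero N] {f : CuspForm (Gamma0 N) 2}
    {ι : (m : ℕ) → (CyclotomicField m ℚ →+* ℂ)} {κ' : ℝ}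
    {Λ' : ∀ (k : ℕ) (r : Finset (HeightOneSpectrum (𝓞 ℚ))),
      H1 (tateRep W p) (cycSubgroup p k r) →ₗ[ℤ_[p]] ℚ_[p] ⊗[ℚ] CyclotomicField (cycLevel p k r) ℚ}
    {c d a : ℤ} {A : ℕ}
    {z : ∀ (k : ℕ) (r : (cyclotomicLevelsRat p (badPlaces c d A N)).Ideals),
      H1 (tateRep W p) ((cyclotomicLevelsRat p (badPlaces c d A N)).level k r.1)}
    {x : ∀ (k : ℕ) (r : (cyclotomicLevelsRat p (badPlaces c d A N)).Ideals),
      CyclotomicField (cycLevel p k r.1) ℚ}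
    (hbody : ZetaBody W p f ι κ' Λ' c d a A z x) (hne : 2 * c.natAbs * d.natAbs * A * N ≠ 0)
    {y : I.H} (hy : ∀ n : ℕ, I.proj n y = levelToLayer W p hκ hp (badPlaces c d A N) n
      (z (n + 1) (cyclotomicLevelsRat p (badPlaces c d A N)).idealOne))
    {V : WeierstrassCurve ℚ} [V.IsElliptic] (hf : IsNewformOf V f) (hL1 : V.entireLFunction 1 ≠ 0)
    (hκ' : κ' ≠ 0) (hA : 0 < A) (d' : ℤ) (hcd : Int.gcd (c * d) A = 1) (hdd' : d * d' ≡ 1 [ZMOD (A : ℤ)])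
    (hR : cuspFactor f true (fun _ ↦ 1) c d a A d' ≠ 0) :
    Finite (endInvariants (W.conjFineSelmerInfty κ γ - 1)) ∧
      Finite (EndCoinvariants (W.conjFineSelmerInfty κ γ - 1)) ∧
      Finite (integralH1 (tateRep W p) p (κ.layerSubgroup 0) ⧸
        Submodule.span ℤ_[p] {(⟨I.proj 0 y, I.proj_mem 0 y⟩ : integralH1 (tateRep W p) p (κ.layerSubgroup 0))}) ∧
      Nat.card (endInvariants (W.conjFineSelmerInfty κ γ - 1)) ∣
        Nat.card (EndCoinvariants (W.conjFineSelmerInfty κ γ - 1)) *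
          Nat.card (integralH1 (tateRep W p) p (κ.layerSubgroup 0) ⧸
            Submodule.span ℤ_[p] {(⟨I.proj 0 y, I.proj_mem 0 y⟩ :
              integralH1 (tateRep W p) p (κ.layerSubgroup 0))}) :=
  natCard_fineSelmer_invariants_dvd_index_of_isEulerSystemClass_of_not_irreducible W p h134 hSerre hLim hFW hp hκ
    hγ hCM hred I Y y (isEulerSystemClass_of_zetaBody W p hκ hp I hbody hne hy)
    (MemberIndexOfValue.not_isOfFinAddOrder_proj_zero_of_zetaBody hκ hp hbody hκ' hf hL1 hA d' hcd hdd' hR hy)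

/-- **Member-free `∃`-form over Z0: on every reducible non-CM rank-0 row with `L(W,1) ≠ 0` there is a non-zero genuine
Λ-adic Euler-system class `𝐲 ∈ 𝐇¹_Γ(T_pW)` (the lift of Kato's `(c,d,a(A))`-zeta family of the newform of `W` for an
admissible datum) with `𝐲₀ = proj₀ 𝐲` of infinite order, `Sel₀(W/ℚ_∞)^Γ`, `Sel₀(W/ℚ_∞)_Γ`,
`H¹(ℤ[1/p],T_pW)/ℤ_p𝐲₀` finite, and `#Sel₀(W/ℚ_∞)^Γ ∣ #Sel₀(W/ℚ_∞)_Γ · [H¹(ℤ[1/p],T_pW) : ℤ_p·𝐲₀]`** — modulo the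
displayed named facts {Z0 `exists_member_eulerSystem_expStar_values`, Kato 13.4, Serre, FW, Lim 3.5}.
[cite: Kato2004Asterisque, Thm. 12.5–12.6 (pp. 221–222), Thm. 13.4 (2) (p. 226), Thm. 14.5 (p. 236)]
[cite: GreenbergLNM1716, §4 Lemma 4.2 (p. 102)] [cite: Wuthrich2014, Lemma 14 (p. 396)] -/
theorem exists_zetaLift_natCard_fineSelmer_invariants_dvd_index
    (hZ0 : exists_member_eulerSystem_expStar_values)
    (h134 : thm13_4_lengthAt_fineSelmerDual_le_of_isEulerSystemClass)
    (hSerre : serre_adicImage_contains_congruenceSubgroup)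
    (hLim : Lim2017.thm35_fineSelmerDual_moduleFinite_of_classicalMuVanishes_of_le_divisionField)
    (hFW : Literature.NumberTheory.IwasawaTheory.ferreroWashington1979_classicalMuVanishes)
    (hp : p ≠ 2) (hκ : κ.IsCyclotomic) (hγ : κ.IsTopGenerator γ) (hCM : ¬ W.HasCM)
    (hred : ¬ W.HasIrreducibleModPGaloisRep p) (I : IwasawaH1Data W p κ γ) (Y : W.FineSelmerDualData κ γ)
    {N : ℕ} [NeZero N] (f : CuspForm (Gamma0 N) 2) (hf : IsNewformOf W f) (hL1 : W.entireLFunction 1 ≠ 0)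
    (ι : (m : ℕ) → (CyclotomicField m ℚ →+* ℂ)) :
    ∃ y : I.H, y ≠ 0 ∧ IsEulerSystemClass W p κ γ I y ∧ ¬ IsOfFinAddOrder (I.proj 0 y) ∧
      Finite (endInvariants (W.conjFineSelmerInfty κ γ - 1)) ∧
      Finite (EndCoinvariants (W.conjFineSelmerInfty κ γ - 1)) ∧
      Finite (integralH1 (tateRep W p) p (κ.layerSubgroup 0) ⧸
        Submodule.span ℤ_[p] {(⟨I.proj 0 y, I.proj_mem 0 y⟩ : integralH1 (tateRep W p) p (κ.layerSubgroup 0))}) ∧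
      Nat.card (endInvariants (W.conjFineSelmerInfty κ γ - 1)) ∣
        Nat.card (EndCoinvariants (W.conjFineSelmerInfty κ γ - 1)) *
          Nat.card (integralH1 (tateRep W p) p (κ.layerSubgroup 0) ⧸
            Submodule.span ℤ_[p] {(⟨I.proj 0 y, I.proj_mem 0 y⟩ :
              integralH1 (tateRep W p) p (κ.layerSubgroup 0))}) := by
  obtain ⟨κ', hκ', Λ', hΛ'⟩ := forall_exists_zetaBody_of_member hZ0 W p f hf ι
  obtain ⟨c, d, a, A, d', hA, hc, hd, hcd, hdd', hR⟩ := valueGuard_satisfiable f hf.1 hf.coeffField_eq_bot p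
  obtain ⟨z, x, hbody⟩ := hΛ' c d a A hA hc hd
  have hne : 2 * c.natAbs * d.natAbs * A * N ≠ 0 :=
    ReducibleZetaDivisibility.two_mul_natAbs_ne_zero_of_gcd (p := p) hA hc hd
  obtain ⟨y, hy, -⟩ := IwasawaH1Data.existsUnique_lift_of_zetaBody p W hκ hp I f ι κ' Λ' c d a A z x hbody
  have hnt : ¬ IsOfFinAddOrder (I.proj 0 y) :=
    MemberIndexOfValue.not_isOfFinAddOrder_proj_zero_of_zetaBody hκ hp hbody hκ' hf hL1 hA d' hcd hdd' hR hy
  have hy0 : y ≠ 0 := by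
    rintro rfl
    exact hnt (by rw [map_zero]; exact isOfFinAddOrder_iff_nsmul_eq_zero.mpr ⟨1, one_pos, by simp⟩)
  exact ⟨y, hy0, isEulerSystemClass_of_zetaBody W p hκ hp I hbody hne hy, hnt,
    natCard_fineSelmer_invariants_dvd_index_zetaLift W p h134 hSerre hLim hFW hp hκ hγ hCM hred I Y hbody hne hy
      hf hL1 hκ' hA d' hcd hdd' hR⟩

end Zeta

end Summit.BirchSwinnertonDyer.BirchSwinnertonDyer.Theorems.ReducibleFineSelmerDescentCount

end
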